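import Mathlib
import HarnessLib
import HarnessLib.Audit
import Summits.ValiantsHypothesis.ValiantsHypothesis.Theorems.SoloBlindFreeRemoval

/-!
# Exposed doubling — the sharpened doubling conjecture for the two-sum vertex count

Solo seat `solo-ValiantsHypothesis-blind` (methods rung below `FgPlusOneLinear`; no path to the summit is claimed).

The doubling conjecture `TwoSumDoubling` bounds the number of strict vertices of `conv W(I) + cone (I∖0)` by
`#(I∖0) + #{a ∈ I∖0 : a + a ∈ I}`.  The kinetic ("sweep") analysis of this seat shows that only doubled atoms which
are the *lowest* atom for some admissible functional ever open a phase of vertices; this file records the resulting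
sharper conjecture, in the form expressible without the sweep: only **exposed** doubled atoms are counted
(`TwoSumExposedDoubling`), and proves that it implies `TwoSumDoubling` (hence `TwoSumFreeLin` and
`TwoSumVertexBoundLin` with constant `2`, by the implications of `SoloBlindFreeRemoval`).

Evidence (exact integer computation, this seat): the finer *phase bound*
`N ≤ #(I∖0) + #{doubled phase atoms} − [first phase atom doubled] − [last phase atom doubled]`
has no violation in 142 058 instances (26 510 of them outside the "no deep atom" regime) and under ≈ 2.5·10⁵
adversarial forcing-closure mutations maximising the excess; it is attained with equality (e.g.
`I∖0 = {(4,2),(5,7),(8,4),(8,15),(11,4),(16,30),(18,34),(38,12),(94,29)}`: 9 atoms, 11 strict vertices, 2 doubled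
phase atoms), and it is a theorem in the pure-doubling case (no additive relations other than doublings).
CONJECTURAL — `TwoSumExposedDoubling` is a named `Prop`, not asserted.
-/

namespace Summit.ValiantsHypothesis.ValiantsHypothesis.Theorems

open Finset

open Classical in
/-- The **exposed doubled atoms** of `I`: atoms `a ∈ I ∖ 0` with `a + a ∈ I` that are *exposed*, i.e. some integer
functional, positive on `I ∖ 0`, is uniquely minimised over `I ∖ 0` at `a` (a vertex of `conv (I∖0) + cone (I∖0)`
seen from the origin side). -/
noncomputable def exposedDoubled (I : Finset (ℤ × ℤ)) : Finset (ℤ × ℤ) :=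
  (I.erase 0).filter (fun a => a + a ∈ I ∧
    ∃ c d : ℤ, (∀ e ∈ I.erase 0, 0 < lin c d e) ∧ ∀ e ∈ I.erase 0, e ≠ a → lin c d a < lin c d e)

/-- **Exposed doubling conjecture** (not asserted): the number of strict vertices is at most the number of atoms
plus the number of *exposed* doubled atoms.  Sharpens `TwoSumDoubling`; see the module docstring for the evidence
and for the still finer phase bound it abstracts. -/
@[conjecture] def TwoSumExposedDoubling : Prop :=
  ∀ I V : Finset (ℤ × ℤ), (∀ v ∈ V, IsStrictVertex I v) →
    V.card ≤ (I.erase 0).card + (exposedDoubled I).card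

/-- The exposed doubled atoms are among the doubled atoms. -/
theorem exposedDoubled_subset_doubled (I : Finset (ℤ × ℤ)) :
    exposedDoubled I ⊆ (I.erase 0).filter (fun a => a + a ∈ I) := by
  classical
  intro a ha
  simp only [exposedDoubled, Finset.mem_filter] at ha
  exact Finset.mem_filter.mpr ⟨ha.1, ha.2.1⟩

/-- The exposed doubling conjecture implies the doubling conjecture. -/
theorem twoSumDoubling_of_exposedDoubling (h : TwoSumExposedDoubling) : TwoSumDoubling := by
  intro I V hV
  have h1 := h I V hV
  have h2 := Finset.card_le_card (exposedDoubled_subset_doubled I)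
  omega

/-- Hence the exposed doubling conjecture implies the linear two-sum bound `TwoSumVertexBoundLin` (constant `2`). -/
theorem twoSumVertexBoundLin_of_exposedDoubling (h : TwoSumExposedDoubling) : TwoSumVertexBoundLin :=
  twoSumVertexBoundLin_of_freeLin (twoSumFreeLin_of_doubling (twoSumDoubling_of_exposedDoubling h))

end Summit.ValiantsHypothesis.ValiantsHypothesis.Theorems
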